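import Summits.HubbardSuperconductivity.HubbardSuperconductivity.Theorems.ChiralWindowCwThesisBlockGroundEnergy
import HarnessLib

/-!
# Crux `CwThesis` (stmt-HubbardSuperconductivity-10438, route `ChiralWindow`), line
`SketchIdeator2` (card `participation-chebyshev-ring`) — stub `stub_sectorGroundStateRestrict`

**Restriction of a sector ground state to Lieb's `(n,n)` block** (the bookkeeping identity of the
line, moving between a ground state `ψ` of `H` in the joint sector `(N, S^z) = (2n, 0)` of the Fock
space of the torus and its restriction `φ a := ψ a.1` to the compressed block `H.toBlock p p`,
`p s := #upPart s = n ∧ #downPart s = n`).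

* `restrict_dotProduct_of_support`, `toBlock_mulVec_restrict_of_support` — generic linear algebra
  over an abstract finite index type `ι` (instances are PARAMETERS, so that the specialisation
  unifies with the structural instances of the Fock space of the torus): for a vector `v`
  vanishing off a decidable predicate `p`, restriction to `{i // p i}` preserves `star v ⬝ᵥ w` and
  intertwines every matrix `A` with its compression `A.toBlock p p` (no invariance needed).
* `stub_sectorGroundStateRestrict` — the registered stub: for `n ≤ L²`, a Hermitian `H`, any matrix
  `A` and a sector ground state `ψ` (`IsGroundStateInSector H (2n) 0 ψ`), the restriction `φ` has
  (i) the same norm, (ii) the same expectation `⟨φ, A_p φ⟩ = ⟨ψ, A ψ⟩`, and (iii) is an eigenvector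
  of `H_p` for the eigenvalue `groundEnergy H_p`: `ψ` vanishes off `p`
  (`mem_szSector_two_mul_zero_iff`), and the sector energy `H.minEnergyOn (szSector (2n) 0)` is the
  block ground energy (`stub_blockGroundEnergy`, line `SketchIdeator3`).

All statements are finite-dimensional linear algebra (Tasaki, *Physics and Mathematics of Quantum
Many-Body Systems* (2020), §2.1–2.2; Lieb, PRL 62 (1989) 1201, "I work in the `S^z = 0` subspace").
No definition is introduced. [folklore]
-/

noncomputable section

namespace Summit.HubbardSuperconductivity.HubbardSuperconductivity.Theorems.CwThesis

-- `dupNamespace`: the summit and the problem are both named `HubbardSuperconductivity` (layout D-0022)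
set_option linter.dupNamespace false
-- the `(n,n)`-sector index type `{s : Finset (Orb Λ) // …}` needs a larger instance budget for
-- `DecidableEq` (structural instance through `Lex (Fin 2 → Fin L)`; tree precedent: GaugedHubbardTorus)
set_option synthInstance.maxSize 512

open Matrix Literature.MathematicalPhysics.QuantumLattice
open scoped ComplexOrder

/-- **Restriction preserves inner products against a vector supported on the block.** If `v`
vanishes off the decidable predicate `p`, then for every `w` the inner product of the restrictions
to `{i // p i}` is `star v ⬝ᵥ w` (the off-block terms vanish). Tasaki (2020) §2.1. [folklore] -/
theorem restrict_dotProduct_of_support {ι : Type*} [Fintype ι] (p : ι → Prop) [DecidablePred p]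
    (v w : ι → ℂ) (hv : ∀ i, ¬ p i → v i = 0) :
    star (fun a : {i // p i} => v a.1) ⬝ᵥ (fun a : {i // p i} => w a.1) = star v ⬝ᵥ w := by
  rw [dotProduct, dotProduct, sum_eq_sum_subtype_of_support p (fun i => star v i * w i)]
  · rfl
  · intro j hj
    rw [Pi.star_apply, hv j hj, star_zero, zero_mul]

/-- **The compression acts as the matrix on vectors supported on the block.** If `v` vanishes off
the decidable predicate `p`, then `A.toBlock p p` applied to the restriction of `v` is the
restriction of `A *ᵥ v` — no invariance of the block under `A` is needed. Tasaki (2020) §2.1.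
[folklore] -/
theorem toBlock_mulVec_restrict_of_support {ι : Type*} [Fintype ι] (p : ι → Prop)
    [DecidablePred p] (A : Matrix ι ι ℂ) (v : ι → ℂ) (hv : ∀ i, ¬ p i → v i = 0) :
    A.toBlock p p *ᵥ (fun a : {i // p i} => v a.1) = fun a : {i // p i} => (A *ᵥ v) a.1 := by
  funext a
  rw [mulVec, dotProduct, mulVec, dotProduct, sum_eq_sum_subtype_of_support p (fun j => A a.1 j * v j)]
  · rfl
  · intro j hj
    rw [hv j hj, mul_zero]

/-- **Restriction of a sector ground state to the `(n,n)` block** (stub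
`stub_sectorGroundStateRestrict` of line `SketchIdeator2` of crux `CwThesis`). On the fermionic Fock
space of the torus of side `L`, for `n ≤ L²`, a Hermitian `H`, any matrix `A` and a ground state `ψ`
of `H` in the joint sector `(N, S^z) = (2n, 0)`, the restriction `φ a := ψ a.1` of `ψ` to Lieb's
`(n,n)` occupation block `p s := #upPart s = n ∧ #downPart s = n` has the same norm, the same
expectation `⟨φ, A_p φ⟩ = ⟨ψ, A ψ⟩` of the compression `A_p = A.toBlock p p`, and is an eigenvector
of `H_p` for the eigenvalue `groundEnergy H_p`: `ψ` vanishes off `p`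
(`mem_szSector_two_mul_zero_iff`), so restriction intertwines `A` with `A_p` on `ψ` with no
invariance needed, and the sector energy `H.minEnergyOn (szSector (2n) 0)` is the block ground
energy (`stub_blockGroundEnergy`). Lieb, PRL 62 (1989) 1201; Tasaki (2020) §2.1–2.2. [folklore] -/
theorem stub_sectorGroundStateRestrict (L : ℕ) {n : ℕ} (hn : n ≤ L ^ 2)
    (H A : Matrix (Finset (Orb (FermionTorus 2 L))) (Finset (Orb (FermionTorus 2 L))) ℂ)
    (hH : H.IsHermitian) (ψ : Fock (Orb (FermionTorus 2 L)))
    (hψ : IsGroundStateInSector H (2 * n) 0 ψ) :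
    star (fun s : {s : Finset (Orb (FermionTorus 2 L)) // (upPart s).card = n ∧ (downPart s).card = n} =>
          ψ s.1) ⬝ᵥ
        (fun s : {s : Finset (Orb (FermionTorus 2 L)) // (upPart s).card = n ∧ (downPart s).card = n} =>
          ψ s.1) = star ψ ⬝ᵥ ψ ∧
      star (fun s : {s : Finset (Orb (FermionTorus 2 L)) // (upPart s).card = n ∧ (downPart s).card = n} =>
            ψ s.1) ⬝ᵥ
          (A.toBlock (fun s => (upPart s).card = n ∧ (downPart s).card = n)
              (fun s => (upPart s).card = n ∧ (downPart s).card = n)) *ᵥ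
            (fun s : {s : Finset (Orb (FermionTorus 2 L)) //
              (upPart s).card = n ∧ (downPart s).card = n} => ψ s.1) = star ψ ⬝ᵥ A *ᵥ ψ ∧
      (H.toBlock (fun s => (upPart s).card = n ∧ (downPart s).card = n)
          (fun s => (upPart s).card = n ∧ (downPart s).card = n)) *ᵥ
          (fun s : {s : Finset (Orb (FermionTorus 2 L)) // (upPart s).card = n ∧ (downPart s).card = n} =>
            ψ s.1) =
        (((H.toBlock (fun s => (upPart s).card = n ∧ (downPart s).card = n)
            (fun s => (upPart s).card = n ∧ (downPart s).card = n)).groundEnergy : ℝ) : ℂ) •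
          (fun s : {s : Finset (Orb (FermionTorus 2 L)) // (upPart s).card = n ∧ (downPart s).card = n} =>
            ψ s.1) := by
  -- `ψ` lies in the joint sector, i.e. vanishes off Lieb's `(n,n)` occupation block
  have hsupp : ∀ s : Finset (Orb (FermionTorus 2 L)),
      ¬((upPart s).card = n ∧ (downPart s).card = n) → ψ s = 0 :=
    (mem_szSector_two_mul_zero_iff n ψ).1 hψ.1
  refine ⟨restrict_dotProduct_of_support _ ψ ψ hsupp, ?_, ?_⟩
  · -- (ii) `⟨φ, A_p φ⟩ = ⟨φ, res (A ψ)⟩ = ⟨ψ, A ψ⟩`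
    rw [toBlock_mulVec_restrict_of_support _ A ψ hsupp]
    exact restrict_dotProduct_of_support _ ψ (A *ᵥ ψ) hsupp
  · -- (iii) `H_p φ = res (H ψ) = res (E • ψ)`, `E = minEnergyOn = groundEnergy H_p`
    rw [toBlock_mulVec_restrict_of_support _ H ψ hsupp, stub_blockGroundEnergy L H hH hn, hψ.2.2]
    rfl

end Summit.HubbardSuperconductivity.HubbardSuperconductivity.Theorems.CwThesis

end
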